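import Mathlib

/-!
# Toolkit for linear spaces of matrices of rank at most two (frames, minors, (P1), (P2))

Support file for crux item `stmt-MatrixMultiplication-10752`
(`Summit.MatrixMultiplication.MatrixMultiplication.Theses.HiddenToeplitzCorners.HiddenCornerLemmaR`),
line `frobenius-dual-short-syzygies`, stub `stub_compressionReduction`; consumed by
`HiddenToeplitzCornersHiddenCornerLemmaRRankTwoSpaces.lean` (the `d ≤ 2` compression split).

Let `A : m × n` have rank `2`.  A *frame* for `A` is `U : m × 2` (a basis of `im A`), a retraction
`Ψ : 2 × m` (`Ψ U = 1`) and preimages `Y : n × 2` (`A Y = U`); then `U Ψ A = A`, `A (1 - Y Ψ A) = 0`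
and `(1 - U Ψ) A = 0` (`hclR_frame_exists`, `hclR_frame_mul_proj`, `hclR_frame_coproj_mul`).
For `B` with `rank B, rank (A + B), rank (A - B) ≤ 2` (e.g. `A, B` in a linear space of matrices of
rank `≤ 2`) two coefficients of the cubic `t ↦ 3 × 3`-minor of `A + tB` (`hclR_minor3_eq_zero`) give
* **(P1)** `hclR_P1` / `hclR_P1_matrix`: `B (ker A) ⊆ im A`, i.e. `B Π = U Ψ B Π` for `Π = 1 - Y Ψ A`;
* **(P2)** `hclR_P2` / `hclR_P2_matrix`: `x ∈ ker A`, `A y = B x ⟹ B y ∈ im A`.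
Both are extracted by `linear_combination` from the minors at `t = 1`, `t = -1` and the minor of `B`
(no generic-parameter argument is needed).  Finally `hclR_rightInverse_of_rank`: a `2 × n` matrix of
rank `2` has a right inverse, and `hclR_ker_to_im_fin` is (P1) in closed form (frame eliminated).
Folklore linear algebra.
-/

set_option linter.dupNamespace false

namespace Summit.MatrixMultiplication.MatrixMultiplication.Theorems

open Matrix

variable {m n : Type*} [Fintype m] [Fintype n]


/-- Entry formula: the pairing of row `i` of `P` with `B` applied to column `j` of `C` is the
`(i,j)` entry of `P (B C)`. -/
theorem hclR_dot_mulVec_col {l o : Type*} (P : Matrix l m ℂ) (B : Matrix m n ℂ) (C : Matrix n o ℂ)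
    (i : l) (j : o) : P i ⬝ᵥ (B *ᵥ fun k => C k j) = (P * (B * C)) i j := by
  simp only [Matrix.mul_apply, dotProduct, Matrix.mulVec]

/-- A matrix of rank `≤ 2` has vanishing `3 × 3` minors, in the coordinate-free form
`det (φ_a ⬝ A v_b)_{a,b} = 0` for any three functionals `φ` and any three vectors `v`. -/
theorem hclR_minor3_eq_zero (A : Matrix m n ℂ) (hA : A.rank ≤ 2) (φ : Fin 3 → m → ℂ)
    (v : Fin 3 → n → ℂ) : (Matrix.of fun a b => φ a ⬝ᵥ (A *ᵥ v b)).det = 0 := by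
  have hM : (Matrix.of fun a b => φ a ⬝ᵥ (A *ᵥ v b)) = Matrix.of φ * (A * (Matrix.of v)ᵀ) := by
    ext a b
    exact hclR_dot_mulVec_col (Matrix.of φ) A (Matrix.of v)ᵀ a b
  by_contra hdet
  have hunit : IsUnit (Matrix.of fun a b => φ a ⬝ᵥ (A *ᵥ v b)) :=
    (Matrix.isUnit_iff_isUnit_det _).mpr (isUnit_iff_ne_zero.mpr hdet)
  have h3 := Matrix.rank_of_isUnit _ hunit
  rw [Fintype.card_fin, hM] at h3
  have := (Matrix.rank_mul_le_right (Matrix.of φ) (A * (Matrix.of v)ᵀ)).trans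
    (Matrix.rank_mul_le_left A _)
  omega

/-- A rank-two matrix `A` admits a frame: `U : m × 2` spanning `im A`, a retraction `Ψ` (`Ψ U = 1`),
and preimages `Y` (`A Y = U`); then `U Ψ A = A` (`U Ψ` is a projection onto `im A`). -/
theorem hclR_frame_exists [DecidableEq m] (A : Matrix m n ℂ) (hA : A.rank = 2) :
    ∃ (U : Matrix m (Fin 2) ℂ) (Ψ : Matrix (Fin 2) m ℂ) (Y : Matrix n (Fin 2) ℂ),
      Ψ * U = 1 ∧ A * Y = U ∧ U * (Ψ * A) = A := by
  set W := LinearMap.range A.mulVecLin with hW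
  have hfin : Module.finrank ℂ W = 2 := hA
  let b := Module.finBasisOfFinrankEq ℂ W hfin
  have hy : ∀ j, ∃ y : n → ℂ, A *ᵥ y = (b j : m → ℂ) := fun j => by
    obtain ⟨y, hy⟩ := LinearMap.mem_range.mp (b j).2
    exact ⟨y, hy⟩
  choose y hy using hy
  set U : Matrix m (Fin 2) ℂ := Matrix.of fun i j => (b j : m → ℂ) i with hU
  set Y : Matrix n (Fin 2) ℂ := Matrix.of fun k j => y j k with hY
  have hAY : A * Y = U := by
    ext i j
    have := congrFun (hy j) i
    simpa [hU, hY, Matrix.mul_apply, Matrix.mulVec, dotProduct] using this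
  have hUc : ∀ c : Fin 2 → ℂ, U *ᵥ c = ((∑ j, c j • b j : W) : m → ℂ) := by
    intro c
    ext i
    simp [hU, Matrix.mulVec, dotProduct, mul_comm]
  have hUinj : LinearMap.ker U.mulVecLin = ⊥ := by
    rw [Matrix.ker_mulVecLin_eq_bot_iff]
    intro c hc
    rw [hUc c] at hc
    have h0 : (∑ j, c j • b j : W) = 0 := (Submodule.coe_eq_zero).mp hc
    funext j
    exact Fintype.linearIndependent_iff.mp b.linearIndependent c h0 j
  obtain ⟨g, hg⟩ := LinearMap.exists_leftInverse_of_injective U.mulVecLin hUinj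
  refine ⟨U, LinearMap.toMatrix' g, Y, ?_, hAY, ?_⟩
  · have : LinearMap.toMatrix' (g.comp U.mulVecLin) = 1 := by
      rw [hg, LinearMap.toMatrix'_id]
    rwa [LinearMap.toMatrix'_comp, ← Matrix.toLin'_apply', LinearMap.toMatrix'_toLin'] at this
  · have hΨU : LinearMap.toMatrix' g * U = 1 := by
      have : LinearMap.toMatrix' (g.comp U.mulVecLin) = 1 := by
        rw [hg, LinearMap.toMatrix'_id]
      rwa [LinearMap.toMatrix'_comp, ← Matrix.toLin'_apply', LinearMap.toMatrix'_toLin'] at this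
    refine Matrix.ext_iff_mulVec.mpr fun v => ?_
    have hv : A *ᵥ v ∈ W := LinearMap.mem_range.mpr ⟨v, rfl⟩
    obtain ⟨c, hc⟩ : ∃ c : Fin 2 → ℂ, A *ᵥ v = U *ᵥ c := by
      refine ⟨b.repr ⟨A *ᵥ v, hv⟩, ?_⟩
      rw [hUc]
      have := b.sum_repr ⟨A *ᵥ v, hv⟩
      rw [this]
    rw [← Matrix.mulVec_mulVec, ← Matrix.mulVec_mulVec, hc, Matrix.mulVec_mulVec, Matrix.mulVec_mulVec,
      Matrix.mul_assoc, hΨU, Matrix.mul_one]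

omit [Fintype n] in
/-- Row `i` of `P` times `A` is row `i` of `P A`. -/
theorem hclR_row_vecMul {l : Type*} (P : Matrix l m ℂ) (A : Matrix m n ℂ) (i : l) :
    P i ᵥ* A = (P * A) i := by
  ext k
  simp only [Matrix.vecMul, dotProduct, Matrix.mul_apply]

omit [Fintype m] in
/-- `A` applied to column `j` of `C` is column `j` of `A C`. -/
theorem hclR_mulVec_col {o : Type*} (A : Matrix m n ℂ) (C : Matrix n o ℂ) (j : o) :
    (A *ᵥ fun k => C k j) = fun i => (A * C) i j := by
  ext i
  simp only [Matrix.mulVec, dotProduct, Matrix.mul_apply]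

/-- **(P1)** If `A` carries the frame `Ψ U = 1`, `A Y = U` and `B`, `A + B`, `A - B` all have rank
`≤ 2`, then `B` maps `ker A` into `im A`: `φ (B x) = 0` whenever `φ A = 0` and `A x = 0`.
(The `t`-coefficient of the `3 × 3` minor of `A + tB` on rows `φ, ψ₀, ψ₁` and columns `x, y₀, y₁`
is `φ (B x)`; it is extracted from the values at `t = 1, -1` and the minor of `B`.) -/
theorem hclR_P1 {A B : Matrix m n ℂ} {U : Matrix m (Fin 2) ℂ} {Ψ : Matrix (Fin 2) m ℂ}
    {Y : Matrix n (Fin 2) ℂ} (hΨU : Ψ * U = 1) (hAY : A * Y = U)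
    (hB : B.rank ≤ 2) (hApB : (A + B).rank ≤ 2) (hAmB : (A - B).rank ≤ 2)
    {φ : m → ℂ} (hφ : φ ᵥ* A = 0) {x : n → ℂ} (hx : A *ᵥ x = 0) : φ ⬝ᵥ (B *ᵥ x) = 0 := by
  have hφA : ∀ v : n → ℂ, φ ⬝ᵥ (A *ᵥ v) = 0 := fun v => by
    rw [Matrix.dotProduct_mulVec, hφ, zero_dotProduct]
  have hAψ : ∀ i j : Fin 2, Ψ i ⬝ᵥ (A *ᵥ fun k => Y k j) = (1 : Matrix (Fin 2) (Fin 2) ℂ) i j :=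
    fun i j => by rw [hclR_dot_mulVec_col, hAY, hΨU]
  have h00 := hAψ 0 0
  have h01 := hAψ 0 1
  have h10 := hAψ 1 0
  have h11 := hAψ 1 1
  simp only [Matrix.one_apply_eq, Matrix.one_apply_ne (by decide : (0 : Fin 2) ≠ 1),
    Matrix.one_apply_ne (by decide : (1 : Fin 2) ≠ 0)] at h00 h01 h10 h11
  have e1 := hclR_minor3_eq_zero (A + B) hApB ![φ, Ψ 0, Ψ 1] ![x, fun k => Y k 0, fun k => Y k 1]
  have e2 := hclR_minor3_eq_zero (A - B) hAmB ![φ, Ψ 0, Ψ 1] ![x, fun k => Y k 0, fun k => Y k 1]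
  have e3 := hclR_minor3_eq_zero B hB ![φ, Ψ 0, Ψ 1] ![x, fun k => Y k 0, fun k => Y k 1]
  simp only [Matrix.det_fin_three, Matrix.of_apply] at e1 e2 e3
  simp [Matrix.add_mulVec, Matrix.sub_mulVec, dotProduct_add, dotProduct_sub, hφA, hx, h00, h01, h10,
    h11] at e1 e2 e3
  linear_combination (e1 - e2) / 2 - e3

/-- The frame identities imply `A Π = 0` for the kernel projection `Π = 1 - Y Ψ A`. -/
theorem hclR_frame_mul_proj {A : Matrix m n ℂ} {U : Matrix m (Fin 2) ℂ} {Ψ : Matrix (Fin 2) m ℂ}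
    {Y : Matrix n (Fin 2) ℂ} (hAY : A * Y = U) (hUΨA : U * (Ψ * A) = A) [DecidableEq n] :
    A * (1 - Y * (Ψ * A)) = 0 := by
  rw [Matrix.mul_sub, Matrix.mul_one, ← Matrix.mul_assoc, hAY, hUΨA, sub_self]

omit [Fintype n] in
/-- The frame identities imply `(1 - U Ψ) A = 0` (the rows of `1 - U Ψ` kill `im A`). -/
theorem hclR_frame_coproj_mul {A : Matrix m n ℂ} {U : Matrix m (Fin 2) ℂ} {Ψ : Matrix (Fin 2) m ℂ}
    (hUΨA : U * (Ψ * A) = A) [DecidableEq m] : (1 - U * Ψ) * A = 0 := by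
  rw [Matrix.sub_mul, Matrix.one_mul, Matrix.mul_assoc, hUΨA, sub_self]

/-- **(P1, matrix form).** Under the hypotheses of (P1), `B Π = U Ψ (B Π)` for the kernel projection
`Π = 1 - Y Ψ A`: the restriction of `B` to `ker A` has image in `im A = im U`. -/
theorem hclR_P1_matrix [DecidableEq m] [DecidableEq n] {A B : Matrix m n ℂ} {U : Matrix m (Fin 2) ℂ}
    {Ψ : Matrix (Fin 2) m ℂ} {Y : Matrix n (Fin 2) ℂ} (hΨU : Ψ * U = 1) (hAY : A * Y = U)
    (hUΨA : U * (Ψ * A) = A) (hB : B.rank ≤ 2) (hApB : (A + B).rank ≤ 2)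
    (hAmB : (A - B).rank ≤ 2) :
    B * (1 - Y * (Ψ * A)) = U * (Ψ * (B * (1 - Y * (Ψ * A)))) := by
  have hAP := hclR_frame_mul_proj hAY hUΨA
  have hφA := hclR_frame_coproj_mul hUΨA
  have key : (1 - U * Ψ) * (B * (1 - Y * (Ψ * A))) = 0 := by
    ext i j
    rw [← hclR_dot_mulVec_col]
    refine hclR_P1 hΨU hAY hB hApB hAmB ?_ ?_
    · rw [hclR_row_vecMul, hφA]
      rfl
    · rw [hclR_mulVec_col, hAP]
      rfl
  rw [Matrix.sub_mul, Matrix.one_mul, sub_eq_zero, Matrix.mul_assoc] at key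
  exact key

/-- **(P2)** With the full frame of `A` (`Ψ U = 1`, `A Y = U`, `U Ψ A = A`): if `B`, `A + B`, `A - B`
have rank `≤ 2`, `x ∈ ker A` and `A y = B x`, then `B y ∈ im A`: `φ (B y) = 0` whenever `φ A = 0`.
(The `t²`-coefficient of the `3 × 3` minor of `A + tB` on rows `φ, ψ₀, ψ₁` and columns `x, y, w` is
`-φ(B y) · det [ψ A y, ψ A w]`; take `w` a frame vector.) -/
theorem hclR_P2 [DecidableEq m] {A B : Matrix m n ℂ} {U : Matrix m (Fin 2) ℂ} {Ψ : Matrix (Fin 2) m ℂ}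
    {Y : Matrix n (Fin 2) ℂ} (hΨU : Ψ * U = 1) (hAY : A * Y = U) (hUΨA : U * (Ψ * A) = A)
    (hB : B.rank ≤ 2) (hApB : (A + B).rank ≤ 2) (hAmB : (A - B).rank ≤ 2)
    {φ : m → ℂ} (hφ : φ ᵥ* A = 0) {x y : n → ℂ} (hx : A *ᵥ x = 0) (hy : A *ᵥ y = B *ᵥ x) :
    φ ⬝ᵥ (B *ᵥ y) = 0 := by
  have hφA : ∀ v : n → ℂ, φ ⬝ᵥ (A *ᵥ v) = 0 := fun v => by
    rw [Matrix.dotProduct_mulVec, hφ, zero_dotProduct]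
  have hAψ : ∀ i j : Fin 2, Ψ i ⬝ᵥ (A *ᵥ fun k => Y k j) = (1 : Matrix (Fin 2) (Fin 2) ℂ) i j :=
    fun i j => by rw [hclR_dot_mulVec_col, hAY, hΨU]
  have h00 := hAψ 0 0
  have h01 := hAψ 0 1
  have h10 := hAψ 1 0
  have h11 := hAψ 1 1
  simp only [Matrix.one_apply_eq, Matrix.one_apply_ne (by decide : (0 : Fin 2) ≠ 1),
    Matrix.one_apply_ne (by decide : (1 : Fin 2) ≠ 0)] at h00 h01 h10 h11
  -- the t²-coefficient identity for a third column w
  have key : ∀ w : n → ℂ, (φ ⬝ᵥ (B *ᵥ y)) *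
      ((Ψ 0 ⬝ᵥ (A *ᵥ y)) * (Ψ 1 ⬝ᵥ (A *ᵥ w)) - (Ψ 1 ⬝ᵥ (A *ᵥ y)) * (Ψ 0 ⬝ᵥ (A *ᵥ w))) = 0 := by
    intro w
    have e1 := hclR_minor3_eq_zero (A + B) hApB ![φ, Ψ 0, Ψ 1] ![x, y, w]
    have e3 := hclR_minor3_eq_zero B hB ![φ, Ψ 0, Ψ 1] ![x, y, w]
    simp only [Matrix.det_fin_three, Matrix.of_apply] at e1 e3
    simp [Matrix.add_mulVec, dotProduct_add, hφA, hx, ← hy] at e1 e3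
    linear_combination e3 - e1
  -- the coordinates a = Ψ A y of A y in the frame
  by_cases ha : Ψ 0 ⬝ᵥ (A *ᵥ y) = 0 ∧ Ψ 1 ⬝ᵥ (A *ᵥ y) = 0
  · -- A y = U (Ψ A y) = 0, so y ∈ ker A and (P1) applies
    have hAy : A *ᵥ y = 0 := by
      have : A *ᵥ y = U *ᵥ (Ψ *ᵥ (A *ᵥ y)) := by
        rw [Matrix.mulVec_mulVec, Matrix.mulVec_mulVec, Matrix.mul_assoc, hUΨA]
      rw [this]
      have h0 : Ψ *ᵥ (A *ᵥ y) = 0 := by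
        ext i
        fin_cases i
        · exact ha.1
        · exact ha.2
      rw [h0, Matrix.mulVec_zero]
    exact hclR_P1 hΨU hAY hB hApB hAmB hφ hAy
  · rw [not_and_or] at ha
    rcases ha with ha | ha
    · have := key (fun k => Y k 1)
      rw [h01, h11] at this
      simpa [ha] using this
    · have := key (fun k => Y k 0)
      rw [h00, h10] at this
      simpa [ha] using this

/-- **(P2, matrix form).** Under the hypotheses of (P2): if `A Xm = 0` and `A Ym = B Xm`
(column by column: `xⱼ ∈ ker A`, `A yⱼ = B xⱼ`), then `(1 - U Ψ) (B Ym) = 0`, i.e. `B Ym` has all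
its columns in `im A`. -/
theorem hclR_P2_matrix [DecidableEq m] {o : Type*} {A B : Matrix m n ℂ} {U : Matrix m (Fin 2) ℂ}
    {Ψ : Matrix (Fin 2) m ℂ} {Y : Matrix n (Fin 2) ℂ} (hΨU : Ψ * U = 1) (hAY : A * Y = U)
    (hUΨA : U * (Ψ * A) = A) (hB : B.rank ≤ 2) (hApB : (A + B).rank ≤ 2)
    (hAmB : (A - B).rank ≤ 2) {Xm Ym : Matrix n o ℂ} (hX : A * Xm = 0) (hY : A * Ym = B * Xm) :
    (1 - U * Ψ) * (B * Ym) = 0 := by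
  ext i j
  rw [← hclR_dot_mulVec_col]
  refine hclR_P2 hΨU hAY hUΨA hB hApB hAmB ?_ (x := fun k => Xm k j) ?_ ?_
  · rw [hclR_row_vecMul, hclR_frame_coproj_mul hUΨA]
    rfl
  · rw [hclR_mulVec_col, hX]
    rfl
  · rw [hclR_mulVec_col, hclR_mulVec_col, hY]

/-- A `2 × n` matrix of rank `≥ 2` is surjective, hence has a right inverse. -/
theorem hclR_rightInverse_of_rank [DecidableEq n] (M : Matrix (Fin 2) n ℂ) (hM : 2 ≤ M.rank) :
    ∃ R : Matrix n (Fin 2) ℂ, M * R = 1 := by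
  have htop : LinearMap.range M.mulVecLin = ⊤ := by
    apply Submodule.eq_top_of_finrank_eq
    apply le_antisymm (Submodule.finrank_le _)
    rw [Module.finrank_fin_fun]
    exact hM
  obtain ⟨g, hg⟩ := LinearMap.exists_rightInverse_of_surjective M.mulVecLin htop
  refine ⟨LinearMap.toMatrix' g, ?_⟩
  have : LinearMap.toMatrix' (M.mulVecLin.comp g) = 1 := by rw [hg, LinearMap.toMatrix'_id]
  rwa [LinearMap.toMatrix'_comp, ← Matrix.toLin'_apply', LinearMap.toMatrix'_toLin'] at this

/-- **(P1), closed form.** In a pencil of complex matrices of rank `≤ 2` through a rank-two matrix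
`A` (`rank B, rank (A + B), rank (A - B) ≤ 2`), every member `B` maps `ker A` into `im A`:
`φ (B x) = 0` whenever `φ A = 0` and `A x = 0`. -/
theorem hclR_ker_to_im_fin : ∀ (m n : ℕ) (A B : Matrix (Fin m) (Fin n) ℂ), A.rank = 2 →
    B.rank ≤ 2 → (A + B).rank ≤ 2 → (A - B).rank ≤ 2 → ∀ (φ : Fin m → ℂ) (x : Fin n → ℂ),
    Matrix.vecMul φ A = 0 → Matrix.mulVec A x = 0 → dotProduct φ (Matrix.mulVec B x) = 0 := by
  intro m n A B hA hB hApB hAmB φ x hφ hx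
  obtain ⟨U, Ψ, Y, hΨU, hAY, -⟩ := hclR_frame_exists A hA
  exact hclR_P1 hΨU hAY hB hApB hAmB hφ hx

end Summit.MatrixMultiplication.MatrixMultiplication.Theorems
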